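import Mathlib
import Summits.Ventures.PercRepro2.ThreeTermPartHarris
import Summits.Ventures.PercRepro2.ThreeTermPartStar

/-!
# Three-terminal parts, IV c: the cone statement of record (3T-CONE), and row 2′TRI on core + every
part and on every star instance from it
(blind cell PercRepro2, night-3 g30, 2026-08-29; `proofs/NIGHT3-CERT.md` §39)

With `typedHarris_part` (ThreeTermPartHarris.lean) the chain «core + any three-terminal part» has ONE
hypothesis left: the core's 5³ partition table lies in the Harris cone `ThreeTerm.InCone` (the
certificate shape of certlp.py, NIGHT3-CERT §37.5; census 526,371 typed + 36,871 weighted tables, 0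
failures; equivalently the 44 facet inequalities of §39.4).  This file names that hypothesis as a
closed statement over all finite instances, **`ThreeTermCone`** — the open statement of record of the
three-terminal line — and records what it gives:

* **`typedCount_part_nonneg_of_threeTermCone`**: `ThreeTermCone → 0 ≤ typedCount (F ∪ S) z τ K₃` for
  EVERY instance carrying an unmarked three-terminal part (any part, any type map on it);
* **`typedCount_star_nonneg'`**: the star instance of ThreeTermStarTypes.lean with NO hypothesis on
  the star's types (g29's `typedCount_star_nonneg` needed types in `{1, 2}` for its kernel `decide`s);
* **`typedCount_star_nonneg_of_threeTermCone`**: `ThreeTermCone → 0 ≤ typedCount (F ∪ {e₁, e₂, e₃}) z τ K₃`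
  at every unmarked vertex of degree three — the degree-3 hard step of S4 for every type pattern at once.

Own work; standard axioms.
-/

namespace Summit.Ventures.PercRepro2

open Block ThreeTerm TypedStar

namespace Part

/-! ## The cone statement of record -/

section ConeAll

/-- **(3T-CONE), the open statement of record of the three-terminal line**: for every finite instance
with an unmarked three-terminal part — a core `(V, E, ends)` with marks `o a₁ a₂ a₃ b` outside the part
`W`, the part's edges `S = touches ends W` with three distinguished distinct edges `e₁ e₂ e₃ ∈ S`, the
other typed edges `F` (disjoint from `S`), a pinning `z` and a type map `τ` — the five-world cubic of the
core's partition table `partTable5` lies in the Harris cone `ThreeTerm.InCone` (`35` monomials and the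
`45` products `μ_p · h_s` of the homogenised Harris slacks; the LP witness of certlp.py). -/
def ThreeTermCone : Prop :=
  ∀ (V E : Type) [Fintype E] [DecidableEq E] (ends : E → Sym2 V) (W : Set V) (t₁ t₂ t₃ : V),
    IsPart ends W t₁ t₂ t₃ → ∀ (S : Finset E), (∀ e, e ∈ S ↔ e ∈ touches ends W) →
    ∀ e₁ e₂ e₃ : E, e₁ ∈ S → e₂ ∈ S → e₃ ∈ S → e₁ ≠ e₂ → e₁ ≠ e₃ → e₂ ≠ e₃ →
    ∀ o a₁ a₂ a₃ b : V, o ∉ W → a₁ ∉ W → a₂ ∉ W → a₃ ∉ W → b ∉ W →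
    ∀ (F : Finset E), Disjoint F S → ∀ (z : Config E) (τ : E → ℕ),
      InCone (fun ν => ∑ p : Fin 5, ∑ q : Fin 5, ∑ r : Fin 5,
        partTable5 ends S e₁ e₂ e₃ t₁ t₂ t₃ o a₁ a₂ a₃ b F z τ p q r * mono p q r ν)

/-- **Row 2′TRI on core + ANY three-terminal part from (3T-CONE)** — no hypothesis on the part. -/
theorem typedCount_part_nonneg_of_threeTermCone (hC : ThreeTermCone) {V E : Type} [Fintype E]
    [DecidableEq E] {ends : E → Sym2 V} {W : Set V} {t₁ t₂ t₃ : V} (hW : IsPart ends W t₁ t₂ t₃)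
    {S : Finset E} (hS : ∀ e, e ∈ S ↔ e ∈ touches ends W) {e₁ e₂ e₃ : E} (h1 : e₁ ∈ S) (h2 : e₂ ∈ S)
    (h3 : e₃ ∈ S) (h12 : e₁ ≠ e₂) (h13 : e₁ ≠ e₃) (h23 : e₂ ≠ e₃) {o a₁ a₂ a₃ b : V} (ho : o ∉ W)
    (ha₁ : a₁ ∉ W) (ha₂ : a₂ ∉ W) (ha₃ : a₃ ∉ W) (hb : b ∉ W) {F : Finset E} (hd : Disjoint F S)
    (z : Config E) (τ : E → ℕ) :
    0 ≤ typedCount (F ∪ S) z τ (CovForm.K3 (R := ℚ) ends o a₁ a₂ a₃ b) :=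
  typedCount_part_nonneg_of_inCone5' hW hS h1 h2 h3 h12 h13 h23 ho ha₁ ha₂ ha₃ hb hd z τ
    (hC V E ends W t₁ t₂ t₃ hW S hS e₁ e₂ e₃ h1 h2 h3 h12 h13 h23 o a₁ a₂ a₃ b ho ha₁ ha₂ ha₃ hb F hd z τ)

end ConeAll

/-! ## Stars of every type pattern -/

section Star

variable {V : Type*} {E : Type*} [Fintype E] [DecidableEq E]
  {ends : E → Sym2 V} {u t₁ t₂ t₃ : V} {e₁ e₂ e₃ : E}

/-- **The star instance with NO hypothesis on the star's types** (compare g29's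
`typedCount_star_nonneg`, which needs types in `{1, 2}`): at an unmarked vertex `u` of degree three, the
typed base is nonnegative for every type map as soon as the core's pattern table is in the cone. -/
theorem typedCount_star_nonneg' (he₁ : ends e₁ = s(u, t₁)) (he₂ : ends e₂ = s(u, t₂))
    (he₃ : ends e₃ = s(u, t₃)) (ht₁ : t₁ ≠ u) (ht₂ : t₂ ≠ u) (ht₃ : t₃ ≠ u)
    (hS : ∀ e, e ∈ ({e₁, e₂, e₃} : Finset E) ↔ e ∈ touches ends {u}) (h12 : e₁ ≠ e₂) (h13 : e₁ ≠ e₃)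
    (h23 : e₂ ≠ e₃) {o a₁ a₂ a₃ b : V} (ho : o ≠ u) (ha₁ : a₁ ≠ u) (ha₂ : a₂ ≠ u) (ha₃ : a₃ ≠ u)
    (hb : b ≠ u) {F : Finset E} (hd : Disjoint F {e₁, e₂, e₃}) (z : Config E) (τ : E → ℕ)
    (hcone : InConeP πpat (cubicOf (partTable ends {e₁, e₂, e₃} e₁ e₂ e₃ t₁ t₂ t₃ o a₁ a₂ a₃ b F z τ))) :
    0 ≤ typedCount (F ∪ {e₁, e₂, e₃}) z τ (CovForm.K3 (R := ℚ) ends o a₁ a₂ a₃ b) :=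
  typedCount_part_nonneg_of_cone (isPart_star he₁ he₂ he₃ ht₁ ht₂ ht₃ hS) hS (by simp) (by simp)
    (by simp) h12 h13 h23 (by simpa using ho) (by simpa using ha₁) (by simpa using ha₂)
    (by simpa using ha₃) (by simpa using hb) hd z τ hcone

end Star

section StarAll

/-- **Every star instance from (3T-CONE)**: at an unmarked vertex `u` of degree three with edges to three
distinct vertices, the typed base of the whole instance is nonnegative for every pinning and every type
map — the degree-3 hard step of S4 for every type pattern of the star at once. -/
theorem typedCount_star_nonneg_of_threeTermCone (hC : ThreeTermCone) {V E : Type} [Fintype E]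
    [DecidableEq E] {ends : E → Sym2 V} {u t₁ t₂ t₃ : V} {e₁ e₂ e₃ : E}
    (he₁ : ends e₁ = s(u, t₁)) (he₂ : ends e₂ = s(u, t₂)) (he₃ : ends e₃ = s(u, t₃)) (ht₁ : t₁ ≠ u)
    (ht₂ : t₂ ≠ u) (ht₃ : t₃ ≠ u) (hS : ∀ e, e ∈ ({e₁, e₂, e₃} : Finset E) ↔ e ∈ touches ends {u})
    (h12 : e₁ ≠ e₂) (h13 : e₁ ≠ e₃) (h23 : e₂ ≠ e₃) {o a₁ a₂ a₃ b : V} (ho : o ≠ u) (ha₁ : a₁ ≠ u)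
    (ha₂ : a₂ ≠ u) (ha₃ : a₃ ≠ u) (hb : b ≠ u) {F : Finset E} (hd : Disjoint F {e₁, e₂, e₃})
    (z : Config E) (τ : E → ℕ) :
    0 ≤ typedCount (F ∪ {e₁, e₂, e₃}) z τ (CovForm.K3 (R := ℚ) ends o a₁ a₂ a₃ b) :=
  typedCount_part_nonneg_of_threeTermCone hC (isPart_star he₁ he₂ he₃ ht₁ ht₂ ht₃ hS) hS (by simp)
    (by simp) (by simp) h12 h13 h23 (by simpa using ho) (by simpa using ha₁) (by simpa using ha₂)
    (by simpa using ha₃) (by simpa using hb) hd z τ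

end StarAll

end Part

end Summit.Ventures.PercRepro2
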